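import Literature.AnabelianGeometry.EtaleTheta.Thm16SubdagThetaLift
import HarnessLib

/-!
# [EtTh] Theorem 1.6 (iii) — sub-DAG row L12 carrier: the Θ-level action `H¹((Π^tp_{Ÿα})^Θ, Δ_Θ) ⥲
# H¹((Π^tp_{Ÿβ})^Θ, Δ_Θ)` induced by `γ` (in particular by an inversion automorphism `ι`), proof-only

Mochizuki, *The étale theta function and its Frobenioid-theoretic manifestations*, Publ. RIMS **45** (2009),
Thm. 1.6 (iii), proof p. 25 l.5–19: "we may assume that the isomorphism `Π^tp_{Ÿα} ⥲ Π^tp_{Ÿβ}` induced by `γ` is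
compatible with suitable “inversion automorphisms” `ια`, `ιβ` [cf. Proposition 1.5, (iii)]"; Prop. 1.5 (iii)
p. 23 (classes of `H¹((Π^tp_Ÿ)^Θ, Δ_Θ)` and the action of automorphisms on them)
[cite: MochizukiEtTh2009, Thm 1.6 (iii) p.25].

abc-iut cell, layer L2, sub-DAG `plan/L2/SUBDAG-EtTh-Thm16.md` (§K row K3; lineage abc-iut-L6-d5, ONE WRITER),
PART 10 — PROOF-ONLY. The capstone (part 7) takes the inversion action as an automorphism `ι` of
`H¹((Π^tp_{Ÿβ})^Θ, Δ_Θ)`; print's `ι` is induced by an automorphism `ι_X` of `Π^tp_X` preserving `Π^tp_Ÿ` (with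
its theta companion). THIS FILE shows such induced Θ-level actions EXIST and are pinned down by abc-iut-L2-t1's
`transport` on `H¹(Π^tp_Ÿ, Δ_Θ)`:
* `Thm16Sub.exists_thetaTransport` — for EVERY class `z ∈ H¹((Π^tp_{Ÿα})^Θ, Δ_Θ)` some
  `z′ ∈ H¹((Π^tp_{Ÿβ})^Θ, Δ_Θ)` inflates to `transport c h (infl z)` (the cocycle `w ↦ γ^Θ(f(γ^Θ⁻¹ w))` of parts
  8/9, built inside the proof — the general form of which parts 8/9 proved the `log(Θ)`- and `F̈²`-refinements);
* `Thm16Sub.exists_thetaTransportEquiv` — hence (inflation being injective, abc-iut-L2-t12's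
  `inflTheta_injective`, and `transport` invertible, file (C)'s `transport_transport_symm` /
  `transport_symm_transport`) there is a group isomorphism `T : H¹((Π^tp_{Ÿα})^Θ, Δ_Θ) ⥲ H¹((Π^tp_{Ÿβ})^Θ, Δ_Θ)`
  with `infl ∘ T = transport ∘ infl`, UNIQUE with this property (`thetaTransportEquiv_unique`); at `α = β`,
  `γ = ι_X` an inversion automorphism, `T` is the Θ-level inversion action the capstone quantifies.
No `def` (the isomorphism is an existential witness assembled from `Classical.choose` inside the proof), no new
`Prop`; [EtTh] is refereed and undisputed; nothing here bears on [IUTchIII] Cor. 3.12; typed ≠ proved.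
-/

noncomputable section

namespace Literature.AnabelianGeometry.EtaleTheta

open Literature.AnabelianGeometry.SemiGraphs

namespace Thm16Sub

variable {p : ℕ} [Fact p.Prime] {Dα Dβ : ThetaSetting p} {γ : Dα.PiTemp ≃ₜ* Dβ.PiTemp}

/-- **Θ-level transport exists for every class**: for `z ∈ H¹((Π^tp_{Ÿα})^Θ, Δ_Θ)` some
`z′ ∈ H¹((Π^tp_{Ÿβ})^Θ, Δ_Θ)` has `infl z′ = transport c h (infl z)` — the class of `w ↦ γ^Θ(f(γ^Θ⁻¹ w))`.
[cite: MochizukiEtTh2009, Thm 1.6 (iii) p.24] -/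
theorem exists_thetaTransport (h : ThetaSetting.Thm16i γ) (c : ThetaSetting.ThetaCompanion γ)
    (z : Dα.H1Theta (Dα.GtpYdd.map Dα.toTheta)) :
    ∃ z' : Dβ.H1Theta (Dβ.GtpYdd.map Dβ.toTheta),
      Dβ.inflTheta Dβ.GtpYdd z' = ThetaSetting.transport c h (Dα.inflTheta Dα.GtpYdd z) := by
  obtain ⟨f, rfl⟩ := QuotientGroup.mk_surjective z
  set θ := c.thetaIso.toMulEquiv with hθ
  have hθc : Continuous fun w : Dβ.GtpTheta => θ.symm w := c.thetaIso.continuous_invFun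
  let g : ↥(Dβ.GtpYdd.map Dβ.toTheta) → ↥Dβ.DeltaTheta := fun w =>
    ⟨θ (f.1 ⟨θ.symm w.1, thetaIso_symm_mem_GtpYddTheta h c w.2⟩).1, c.apply_mem _⟩
  have hg_apply : ∀ w : ↥(Dβ.GtpYdd.map Dβ.toTheta),
      ((g w : Dβ.DeltaTheta) : Dβ.GtpTheta) =
        θ (f.1 ⟨θ.symm w.1, thetaIso_symm_mem_GtpYddTheta h c w.2⟩).1 := fun w => rfl
  have hg : g ∈ contCocycles (MonoidHom.id Dβ.GtpTheta) Dβ.DeltaTheta (Dβ.GtpYdd.map Dβ.toTheta) := by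
    refine ⟨?_, fun u w => ?_⟩
    · apply continuous_induced_rng.2
      change Continuous fun w : ↥(Dβ.GtpYdd.map Dβ.toTheta) =>
        (θ (f.1 ⟨θ.symm w.1, thetaIso_symm_mem_GtpYddTheta h c w.2⟩).1 : Dβ.GtpTheta)
      exact (map_continuous c.thetaIso).comp (continuous_subtype_val.comp (f.2.1.comp
        ((hθc.comp continuous_subtype_val).subtype_mk _)))
    · have huw : (⟨θ.symm (u * w).1, thetaIso_symm_mem_GtpYddTheta h c (u * w).2⟩ :
            ↥(Dα.GtpYdd.map Dα.toTheta)) =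
          ⟨θ.symm u.1, thetaIso_symm_mem_GtpYddTheta h c u.2⟩ *
            ⟨θ.symm w.1, thetaIso_symm_mem_GtpYddTheta h c w.2⟩ := by
        apply Subtype.ext
        simp only [Subgroup.coe_mul, MulMemClass.mk_mul_mk, map_mul]
      apply Subtype.ext
      rw [Subgroup.coe_mul, hg_apply, hg_apply, huw, f.2.2]
      simp only [Subgroup.coe_mul, MulAut.conjNormal_apply, MonoidHom.id_apply, map_mul, map_inv,
        MulEquiv.apply_symm_apply, hg_apply]
  refine ⟨QuotientGroup.mk ⟨g, hg⟩, ?_⟩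
  change (QuotientGroup.mk (ContH1.inflCocycle Dβ.DeltaTheta Dβ.toTheta Dβ.continuous_toTheta le_rfl
      ⟨g, hg⟩) : Dβ.H1 Dβ.GtpYdd) =
    QuotientGroup.mk (ThetaSetting.transportCocycle c h
      (ContH1.inflCocycle Dα.DeltaTheta Dα.toTheta Dα.continuous_toTheta le_rfl f))
  congr 1
  apply Subtype.ext
  funext y
  apply Subtype.ext
  change ((g ⟨Dβ.toTheta y.1, _⟩ : Dβ.DeltaTheta) : Dβ.GtpTheta) =
    c.thetaIso (f.1 ⟨Dα.toTheta (γ.toMulEquiv.symm y.1), _⟩).1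
  rw [hg_apply]
  change θ (f.1 ⟨θ.symm (Dβ.toTheta y.1), _⟩).1 = θ (f.1 ⟨Dα.toTheta (γ.toMulEquiv.symm y.1), _⟩).1
  exact congrArg (fun u : ↥(Dα.GtpYdd.map Dα.toTheta) => θ (f.1 u).1)
    (Subtype.ext (thetaIso_symm_toTheta c y.1))

/-- **The Θ-level action induced by `γ` EXISTS as a group isomorphism** `T : H¹((Π^tp_{Ÿα})^Θ, Δ_Θ) ⥲
H¹((Π^tp_{Ÿβ})^Θ, Δ_Θ)` with `infl ∘ T = transport ∘ infl` (inflation injective; `transport` invertible).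
At `α = β`, `γ = ι_X` an inversion automorphism of `Π^tp_X` preserving `Π^tp_Ÿ`, `T` is the inversion action on
`H¹((Π^tp_Ÿ)^Θ, Δ_Θ)` of Prop. 1.5 (iii) / Thm. 1.6 (iii). [cite: MochizukiEtTh2009, Thm 1.6 (iii) p.25] -/
theorem exists_thetaTransportEquiv (h : ThetaSetting.Thm16i γ) (c : ThetaSetting.ThetaCompanion γ) :
    ∃ T : Dα.H1Theta (Dα.GtpYdd.map Dα.toTheta) ≃* Dβ.H1Theta (Dβ.GtpYdd.map Dβ.toTheta),
      ∀ z, Dβ.inflTheta Dβ.GtpYdd (T z) = ThetaSetting.transport c h (Dα.inflTheta Dα.GtpYdd z) := by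
  classical
  -- the forward map, by choice
  let Tf : Dα.H1Theta (Dα.GtpYdd.map Dα.toTheta) → Dβ.H1Theta (Dβ.GtpYdd.map Dβ.toTheta) :=
    fun z => Classical.choose (exists_thetaTransport h c z)
  have hTf : ∀ z, Dβ.inflTheta Dβ.GtpYdd (Tf z) =
      ThetaSetting.transport c h (Dα.inflTheta Dα.GtpYdd z) :=
    fun z => Classical.choose_spec (exists_thetaTransport h c z)
  have hinjβ := Dβ.inflTheta_injective Dβ.GtpYdd
  have hinjα := Dα.inflTheta_injective Dα.GtpYdd
  -- it is a homomorphism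
  let Th : Dα.H1Theta (Dα.GtpYdd.map Dα.toTheta) →* Dβ.H1Theta (Dβ.GtpYdd.map Dβ.toTheta) :=
    { toFun := Tf
      map_one' := hinjβ (by rw [hTf, map_one, map_one, map_one])
      map_mul' := fun a b => hinjβ (by rw [hTf, map_mul, map_mul, map_mul, hTf, hTf]) }
  -- it is bijective
  have hinj : Function.Injective Th := by
    intro a b hab
    have := congrArg (Dβ.inflTheta Dβ.GtpYdd) hab
    change Dβ.inflTheta Dβ.GtpYdd (Tf a) = Dβ.inflTheta Dβ.GtpYdd (Tf b) at this
    rw [hTf, hTf] at this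
    exact hinjα (transport_injective c h this)
  have hsurj : Function.Surjective Th := by
    intro y
    -- transport `y` back along `(γ⁻¹, (γ^Θ)⁻¹)` at the Θ-level, then forward again
    obtain ⟨x, hx⟩ := exists_thetaTransport (thm16i_symm h) (companionSymm c) y
    refine ⟨x, hinjβ ?_⟩
    change Dβ.inflTheta Dβ.GtpYdd (Tf x) = Dβ.inflTheta Dβ.GtpYdd y
    rw [hTf, hx, transport_transport_symm]
  exact ⟨MulEquiv.ofBijective Th ⟨hinj, hsurj⟩, fun z => hTf z⟩

/-- **Uniqueness**: the Θ-level action is determined by the intertwining relation `infl ∘ T = transport ∘ infl`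
(inflation is injective). [cite: MochizukiEtTh2009, Thm 1.6 (iii) p.25] -/
theorem thetaTransportEquiv_unique (h : ThetaSetting.Thm16i γ) (c : ThetaSetting.ThetaCompanion γ)
    (T T' : Dα.H1Theta (Dα.GtpYdd.map Dα.toTheta) ≃* Dβ.H1Theta (Dβ.GtpYdd.map Dβ.toTheta))
    (hT : ∀ z, Dβ.inflTheta Dβ.GtpYdd (T z) = ThetaSetting.transport c h (Dα.inflTheta Dα.GtpYdd z))
    (hT' : ∀ z, Dβ.inflTheta Dβ.GtpYdd (T' z) = ThetaSetting.transport c h (Dα.inflTheta Dα.GtpYdd z)) :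
    T = T' :=
  MulEquiv.ext fun z => Dβ.inflTheta_injective Dβ.GtpYdd (by rw [hT, hT'])

end Thm16Sub

end Literature.AnabelianGeometry.EtaleTheta

end
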